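import Mathlib
import Summits.ValiantsHypothesis.ValiantsHypothesis.Theorems.NewtonUnitEquationsNewtonTauWeakExposedChordUnique

/-!
# `NewtonUnitEquationsNewtonTauWeakSingleMovePairBound` — exposed pairs joined by a single move are few

Line `binomial-normal-form` of crux `NewtonTauWeak` (stmt-ValiantsHypothesis-5904), lead c7, stub P9
(`stub_singleMovePairBound`, the registered text verbatim).

A `c`-core design `h : Fin c → Finset (Fin x) → ℕ²` gives each configuration `f : Fin x → Fin c` (attached element
`v` joins core `f v`) the point `P f = Σ_d h d (f⁻¹ d)`.  A point of the cloud `{P f}` is *strictly positively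
exposed* when it is the strict minimiser over the cloud of some functional `w₀ x₀ + w₁ x₁` with `w₀, w₁ > 0`.
P9: the ordered pairs `(p, p')` of DISTINCT exposed points with `p = P f`, `p' = P (update f u d')` for some
`f, u, d'` (a single move of one attached element) number at most `x · c² · 3^x`.

## Proof

* `fibre_update_of_ne` / `fibre_update_self` / `fibre_update_new`: the fibres of `update f u d'` with `d := f u ≠ d'`
  are those of `f` away from `d, d'`, `f⁻¹ d ∖ {u}` over `d`, and `f⁻¹ d' ∪ {u}` over `d'`.
* `sum_swap_two`, `point_update`, `diff_update`: hence, coordinatewise in `ℤ`,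
  `P (update f u d') − P f = h d T₁ + h d' (T₂ ∪ {u}) − h d (T₁ ∪ {u}) − h d' T₂`
  with `T₁ = f⁻¹ d ∖ {u}`, `T₂ = f⁻¹ d'`.
* `filter_tau_one` / `filter_tau_two`, `diff_datum`: `T₁, T₂` are disjoint, so they are the level sets `{τ = 1}`,
  `{τ = 2}` of their trace `τ : Fin x → Fin 3`; the difference vector is a function of the DATUM `(u, d, d', τ)`.
* `exposed_range`, `eq_of_diff_eq`: by the landed P8 `stub_exposedChordUnique` (a nonzero difference vector occurs
  at most once among exposed points) two pairs with the same difference vector coincide.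
* `pair_bound`: so the pair set injects into `Fin x × Fin c × Fin c × (Fin x → Fin 3)`, of cardinality
  `x · c² · 3^x` (`Nat.card_le_card_of_injective`); the registered stub is `pair_bound` applied to the set-builder
  set of the statement.

Helpers live in the sub-namespace `SingleMovePairBoundAux`; Mathlib and the landed P8 only; no `def`s; everything
is [folklore].
-/

-- justification: the namespace mandated for this Theorems file repeats the component `ValiantsHypothesis`
set_option linter.dupNamespace false -- single-conjunct summit layout `ValiantsHypothesis.ValiantsHypothesis`

open scoped BigOperators

namespace Summit.ValiantsHypothesis.ValiantsHypothesis.Theorems.NewtonUnitEquationsNewtonTauWeak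

namespace SingleMovePairBoundAux

variable {c x : ℕ}

/-- Away from the two affected cores `f u` and `d'`, the fibres of `update f u d'` are those of `f`. [folklore] -/
theorem fibre_update_of_ne (f : Fin x → Fin c) (u : Fin x) (d' e : Fin c) (he : e ≠ f u) (he' : e ≠ d') :
    (Finset.univ.filter fun v => Function.update f u d' v = e) = Finset.univ.filter fun v => f v = e := by
  ext v
  simp only [Finset.mem_filter, Finset.mem_univ, true_and, Function.update_apply]
  by_cases hv : v = u
  · rw [if_pos hv, hv]
    exact ⟨fun h1 => (he' h1.symm).elim, fun h2 => (he h2.symm).elim⟩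
  · rw [if_neg hv]

/-- The fibre of `update f u d'` over the old core `f u ≠ d'` is the old fibre with `u` removed. [folklore] -/
theorem fibre_update_self (f : Fin x → Fin c) (u : Fin x) (d' : Fin c) (hd : f u ≠ d') :
    (Finset.univ.filter fun v => Function.update f u d' v = f u) =
      (Finset.univ.filter fun v => f v = f u).erase u := by
  ext v
  simp only [Finset.mem_filter, Finset.mem_univ, true_and, Function.update_apply, Finset.mem_erase]
  by_cases hv : v = u
  · rw [if_pos hv]
    exact ⟨fun h1 => (hd h1.symm).elim, fun h2 => (h2.1 hv).elim⟩
  · rw [if_neg hv]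
    exact ⟨fun h1 => ⟨hv, h1⟩, fun h2 => h2.2⟩

/-- The fibre of `update f u d'` over the new core `d'` is the old fibre with `u` added. [folklore] -/
theorem fibre_update_new (f : Fin x → Fin c) (u : Fin x) (d' : Fin c) :
    (Finset.univ.filter fun v => Function.update f u d' v = d') =
      insert u (Finset.univ.filter fun v => f v = d') := by
  ext v
  simp only [Finset.mem_filter, Finset.mem_univ, true_and, Function.update_apply, Finset.mem_insert]
  by_cases hv : v = u
  · rw [if_pos hv]
    exact ⟨fun _ => Or.inl hv, fun _ => rfl⟩
  · rw [if_neg hv]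
    exact ⟨fun h1 => Or.inr h1, fun h2 => h2.resolve_left hv⟩

/-- Two sums over `Fin c` whose terms agree away from `d ≠ d'` differ only by the two special terms
(stated additively, without subtraction). [folklore] -/
theorem sum_swap_two {A : Type*} [AddCommMonoid A] (F G : Fin c → A) {d d' : Fin c} (hdd : d' ≠ d)
    (hFG : ∀ e, e ≠ d → e ≠ d' → G e = F e) :
    (∑ e, G e) + (F d + F d') = (∑ e, F e) + (G d + G d') := by
  have hm : d' ∈ Finset.univ.erase d := Finset.mem_erase.mpr ⟨hdd, Finset.mem_univ _⟩
  have hrest : ∑ e ∈ (Finset.univ.erase d).erase d', G e = ∑ e ∈ (Finset.univ.erase d).erase d', F e := by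
    refine Finset.sum_congr rfl fun e he => ?_
    obtain ⟨hed', hed⟩ := Finset.mem_erase.mp he
    exact hFG e (Finset.mem_erase.mp hed).1 hed'
  rw [← Finset.add_sum_erase Finset.univ G (Finset.mem_univ d), ← Finset.add_sum_erase _ G hm,
    ← Finset.add_sum_erase Finset.univ F (Finset.mem_univ d), ← Finset.add_sum_erase _ F hm, hrest]
  abel

/-- The point after one move against the point before it, additively: with `d = f u ≠ d'`,
`T₁ = f⁻¹ d ∖ {u}`, `T₂ = f⁻¹ d'`,
`P (update f u d') + (h d (T₁ ∪ {u}) + h d' T₂) = P f + (h d T₁ + h d' (T₂ ∪ {u}))`. [folklore] -/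
theorem point_update (h : Fin c → Finset (Fin x) → (Fin 2 →₀ ℕ)) (f : Fin x → Fin c) (u : Fin x)
    (d' : Fin c) (hd : f u ≠ d') :
    (∑ e, h e (Finset.univ.filter fun v => Function.update f u d' v = e)) +
        (h (f u) (insert u ((Finset.univ.filter fun v => f v = f u).erase u)) +
          h d' (Finset.univ.filter fun v => f v = d')) =
      (∑ e, h e (Finset.univ.filter fun v => f v = e)) +
        (h (f u) ((Finset.univ.filter fun v => f v = f u).erase u) +
          h d' (insert u (Finset.univ.filter fun v => f v = d'))) := by
  have hu : u ∈ Finset.univ.filter fun v => f v = f u := Finset.mem_filter.mpr ⟨Finset.mem_univ u, rfl⟩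
  rw [Finset.insert_erase hu, ← fibre_update_self f u d' hd, ← fibre_update_new f u d']
  exact sum_swap_two (fun e => h e (Finset.univ.filter fun v => f v = e))
    (fun e => h e (Finset.univ.filter fun v => Function.update f u d' v = e)) (Ne.symm hd)
    (fun e he he' => by simp only [fibre_update_of_ne f u d' e he he'])

/-- The coordinates of the single-move difference vector, in `ℤ`: with `d = f u ≠ d'`, `T₁ = f⁻¹ d ∖ {u}`,
`T₂ = f⁻¹ d'`, `(P (update f u d'))ᵢ − (P f)ᵢ = (h d T₁)ᵢ + (h d' (T₂ ∪ {u}))ᵢ − (h d (T₁ ∪ {u}))ᵢ − (h d' T₂)ᵢ`.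
[folklore] -/
theorem diff_update (h : Fin c → Finset (Fin x) → (Fin 2 →₀ ℕ)) (f : Fin x → Fin c) (u : Fin x)
    (d' : Fin c) (hd : f u ≠ d') (i : Fin 2) :
    (((∑ e, h e (Finset.univ.filter fun v => Function.update f u d' v = e)) i : ℕ) : ℤ) -
        (((∑ e, h e (Finset.univ.filter fun v => f v = e)) i : ℕ) : ℤ) =
      ((h (f u) ((Finset.univ.filter fun v => f v = f u).erase u) i : ℕ) : ℤ) +
        ((h d' (insert u (Finset.univ.filter fun v => f v = d')) i : ℕ) : ℤ) -
        ((h (f u) (insert u ((Finset.univ.filter fun v => f v = f u).erase u)) i : ℕ) : ℤ) -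
        ((h d' (Finset.univ.filter fun v => f v = d') i : ℕ) : ℤ) := by
  have key := DFunLike.congr_fun (point_update h f u d' hd) i
  simp only [Finsupp.add_apply] at key
  omega

/-- The level set `{τ = 1}` of the trace `τ` of two sets `T₁, T₂` is `T₁`. [folklore] -/
theorem filter_tau_one (T₁ T₂ : Finset (Fin x)) :
    (Finset.univ.filter fun v => (if v ∈ T₁ then (1 : Fin 3) else if v ∈ T₂ then 2 else 0) = 1) = T₁ := by
  ext v
  simp only [Finset.mem_filter, Finset.mem_univ, true_and]
  constructor
  · intro h'
    by_contra h1
    rw [if_neg h1] at h'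
    by_cases h2 : v ∈ T₂
    · rw [if_pos h2] at h'
      exact absurd h' (by decide)
    · rw [if_neg h2] at h'
      exact absurd h' (by decide)
  · intro h1
    rw [if_pos h1]

/-- The level set `{τ = 2}` of the trace `τ` of two disjoint sets `T₁, T₂` is `T₂`. [folklore] -/
theorem filter_tau_two (T₁ T₂ : Finset (Fin x)) (hdisj : ∀ v ∈ T₂, v ∉ T₁) :
    (Finset.univ.filter fun v => (if v ∈ T₁ then (1 : Fin 3) else if v ∈ T₂ then 2 else 0) = 2) = T₂ := by
  ext v
  simp only [Finset.mem_filter, Finset.mem_univ, true_and]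
  constructor
  · intro h'
    by_contra h2
    by_cases h1 : v ∈ T₁
    · rw [if_pos h1] at h'
      exact absurd h' (by decide)
    · rw [if_neg h1, if_neg h2] at h'
      exact absurd h' (by decide)
  · intro h2
    rw [if_neg (hdisj v h2), if_pos h2]

/-- The single-move difference vector is a function of the datum `(u, d, d', τ)`: with `d = f u ≠ d'`,
`T₁ = f⁻¹ d ∖ {u}`, `T₂ = f⁻¹ d'` and `τ` the trace of the disjoint pair `(T₁, T₂)` one has `T₁ = {τ = 1}`,
`T₂ = {τ = 2}`, so `diff_update` reads off the datum. [folklore] -/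
theorem diff_datum (h : Fin c → Finset (Fin x) → (Fin 2 →₀ ℕ)) (f : Fin x → Fin c) (u : Fin x) (d' : Fin c)
    (hd : f u ≠ d') :
    ∃ τ : Fin x → Fin 3, ∀ i : Fin 2,
      (((∑ e, h e (Finset.univ.filter fun v => Function.update f u d' v = e)) i : ℕ) : ℤ) -
          (((∑ e, h e (Finset.univ.filter fun v => f v = e)) i : ℕ) : ℤ) =
        ((h (f u) (Finset.univ.filter fun v => τ v = 1) i : ℕ) : ℤ) +
          ((h d' (insert u (Finset.univ.filter fun v => τ v = 2)) i : ℕ) : ℤ) -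
          ((h (f u) (insert u (Finset.univ.filter fun v => τ v = 1)) i : ℕ) : ℤ) -
          ((h d' (Finset.univ.filter fun v => τ v = 2) i : ℕ) : ℤ) := by
  have hdisj : ∀ v ∈ (Finset.univ.filter fun v => f v = d'),
      v ∉ (Finset.univ.filter fun v => f v = f u).erase u := by
    intro v hv2 hv1
    simp only [Finset.mem_filter, Finset.mem_univ, true_and, Finset.mem_erase] at hv2 hv1
    exact hd (hv1.2.symm.trans hv2)
  refine ⟨fun v => if v ∈ (Finset.univ.filter fun v => f v = f u).erase u then (1 : Fin 3)
    else if v ∈ (Finset.univ.filter fun v => f v = d') then 2 else 0, fun i => ?_⟩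
  rw [filter_tau_one, filter_tau_two _ _ hdisj]
  exact diff_update h f u d' hd i

/-- Exposedness against all configurations is exposedness in the cloud `Set.range P`. [folklore] -/
theorem exposed_range (h : Fin c → Finset (Fin x) → (Fin 2 →₀ ℕ)) (p : Fin 2 →₀ ℕ)
    (hp : ∃ w : Fin 2 → ℝ, 0 < w 0 ∧ 0 < w 1 ∧ ∀ f' : Fin x → Fin c,
      ∑ d, h d (Finset.univ.filter fun u => f' u = d) ≠ p →
        w 0 * ((p 0 : ℕ) : ℝ) + w 1 * ((p 1 : ℕ) : ℝ) <
          w 0 * (((∑ d, h d (Finset.univ.filter fun u => f' u = d)) 0 : ℕ) : ℝ) +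
            w 1 * (((∑ d, h d (Finset.univ.filter fun u => f' u = d)) 1 : ℕ) : ℝ)) :
    ∃ w : Fin 2 → ℝ, 0 < w 0 ∧ 0 < w 1 ∧
      ∀ r ∈ Set.range (fun f : Fin x → Fin c => ∑ d, h d (Finset.univ.filter fun u => f u = d)), r ≠ p →
        w 0 * ((p 0 : ℕ) : ℝ) + w 1 * ((p 1 : ℕ) : ℝ) < w 0 * ((r 0 : ℕ) : ℝ) + w 1 * ((r 1 : ℕ) : ℝ) := by
  obtain ⟨w, h0, h1, hw⟩ := hp
  refine ⟨w, h0, h1, ?_⟩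
  rintro r ⟨f', rfl⟩ hne
  exact hw f' hne

/-- Two single-move pairs `(p, p')`, `(q, q')` of exposed points with `p ≠ p'` and the same difference vector
`p' − p = q' − q` coincide: `p = q` by P8 `stub_exposedChordUnique` in the cloud `Set.range P`, then `p' = q'`
coordinatewise. [folklore] -/
theorem eq_of_diff_eq (h : Fin c → Finset (Fin x) → (Fin 2 →₀ ℕ)) (p p' q q' : Fin 2 →₀ ℕ)
    (hp : ∃ f : Fin x → Fin c, ∑ d, h d (Finset.univ.filter fun u => f u = d) = p ∧
      ∃ w : Fin 2 → ℝ, 0 < w 0 ∧ 0 < w 1 ∧ ∀ f' : Fin x → Fin c,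
        ∑ d, h d (Finset.univ.filter fun u => f' u = d) ≠ p →
          w 0 * ((p 0 : ℕ) : ℝ) + w 1 * ((p 1 : ℕ) : ℝ) <
            w 0 * (((∑ d, h d (Finset.univ.filter fun u => f' u = d)) 0 : ℕ) : ℝ) +
              w 1 * (((∑ d, h d (Finset.univ.filter fun u => f' u = d)) 1 : ℕ) : ℝ))
    (hp' : ∃ f : Fin x → Fin c, ∑ d, h d (Finset.univ.filter fun u => f u = d) = p' ∧
      ∃ w : Fin 2 → ℝ, 0 < w 0 ∧ 0 < w 1 ∧ ∀ f' : Fin x → Fin c,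
        ∑ d, h d (Finset.univ.filter fun u => f' u = d) ≠ p' →
          w 0 * ((p' 0 : ℕ) : ℝ) + w 1 * ((p' 1 : ℕ) : ℝ) <
            w 0 * (((∑ d, h d (Finset.univ.filter fun u => f' u = d)) 0 : ℕ) : ℝ) +
              w 1 * (((∑ d, h d (Finset.univ.filter fun u => f' u = d)) 1 : ℕ) : ℝ))
    (hq : ∃ f : Fin x → Fin c, ∑ d, h d (Finset.univ.filter fun u => f u = d) = q ∧
      ∃ w : Fin 2 → ℝ, 0 < w 0 ∧ 0 < w 1 ∧ ∀ f' : Fin x → Fin c,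
        ∑ d, h d (Finset.univ.filter fun u => f' u = d) ≠ q →
          w 0 * ((q 0 : ℕ) : ℝ) + w 1 * ((q 1 : ℕ) : ℝ) <
            w 0 * (((∑ d, h d (Finset.univ.filter fun u => f' u = d)) 0 : ℕ) : ℝ) +
              w 1 * (((∑ d, h d (Finset.univ.filter fun u => f' u = d)) 1 : ℕ) : ℝ))
    (hq' : ∃ f : Fin x → Fin c, ∑ d, h d (Finset.univ.filter fun u => f u = d) = q' ∧
      ∃ w : Fin 2 → ℝ, 0 < w 0 ∧ 0 < w 1 ∧ ∀ f' : Fin x → Fin c,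
        ∑ d, h d (Finset.univ.filter fun u => f' u = d) ≠ q' →
          w 0 * ((q' 0 : ℕ) : ℝ) + w 1 * ((q' 1 : ℕ) : ℝ) <
            w 0 * (((∑ d, h d (Finset.univ.filter fun u => f' u = d)) 0 : ℕ) : ℝ) +
              w 1 * (((∑ d, h d (Finset.univ.filter fun u => f' u = d)) 1 : ℕ) : ℝ))
    (hne : p ≠ p')
    (hv : ∀ i : Fin 2, ((p' i : ℕ) : ℤ) - ((p i : ℕ) : ℤ) = ((q' i : ℕ) : ℤ) - ((q i : ℕ) : ℤ)) :
    p = q ∧ p' = q' := by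
  obtain ⟨fp, hfp, ep⟩ := hp
  obtain ⟨fp', hfp', ep'⟩ := hp'
  obtain ⟨fq, hfq, eq0⟩ := hq
  obtain ⟨fq', hfq', eq1⟩ := hq'
  have hpq : p = q := by
    refine stub_exposedChordUnique
      (Set.range fun f : Fin x → Fin c => ∑ d, h d (Finset.univ.filter fun u => f u = d)) p p' q q'
      ⟨fp, hfp⟩ ⟨fp', hfp'⟩ ⟨fq, hfq⟩ ⟨fq', hfq'⟩ ?_ hne ?_ ?_
    · rintro m (rfl | rfl | rfl | rfl)
      · exact exposed_range h _ ep
      · exact exposed_range h _ ep'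
      · exact exposed_range h _ eq0
      · exact exposed_range h _ eq1
    · have := hv 0
      omega
    · have := hv 1
      omega
  refine ⟨hpq, ?_⟩
  subst hpq
  ext i
  have := hv i
  omega

/-- The datum injection: a set `M` of pairs of distinct exposed points joined by single moves has at most
`x · c² · 3^x` elements, because `m ↦ (u, d, d', τ)` (any datum of a move realising `m`, `diff_datum`) is
injective on `M` by `eq_of_diff_eq`, with values in `Fin x × Fin c × Fin c × (Fin x → Fin 3)`. [folklore] -/
theorem pair_bound (h : Fin c → Finset (Fin x) → (Fin 2 →₀ ℕ)) (M : Set ((Fin 2 →₀ ℕ) × (Fin 2 →₀ ℕ)))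
    (h1 : ∀ m ∈ M, ∃ f : Fin x → Fin c, ∑ d, h d (Finset.univ.filter fun u => f u = d) = m.1 ∧
      ∃ w : Fin 2 → ℝ, 0 < w 0 ∧ 0 < w 1 ∧ ∀ f' : Fin x → Fin c,
        ∑ d, h d (Finset.univ.filter fun u => f' u = d) ≠ m.1 →
          w 0 * ((m.1 0 : ℕ) : ℝ) + w 1 * ((m.1 1 : ℕ) : ℝ) <
            w 0 * (((∑ d, h d (Finset.univ.filter fun u => f' u = d)) 0 : ℕ) : ℝ) +
              w 1 * (((∑ d, h d (Finset.univ.filter fun u => f' u = d)) 1 : ℕ) : ℝ))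
    (h2 : ∀ m ∈ M, ∃ f : Fin x → Fin c, ∑ d, h d (Finset.univ.filter fun u => f u = d) = m.2 ∧
      ∃ w : Fin 2 → ℝ, 0 < w 0 ∧ 0 < w 1 ∧ ∀ f' : Fin x → Fin c,
        ∑ d, h d (Finset.univ.filter fun u => f' u = d) ≠ m.2 →
          w 0 * ((m.2 0 : ℕ) : ℝ) + w 1 * ((m.2 1 : ℕ) : ℝ) <
            w 0 * (((∑ d, h d (Finset.univ.filter fun u => f' u = d)) 0 : ℕ) : ℝ) +
              w 1 * (((∑ d, h d (Finset.univ.filter fun u => f' u = d)) 1 : ℕ) : ℝ))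
    (h3 : ∀ m ∈ M, m.1 ≠ m.2)
    (h4 : ∀ m ∈ M, ∃ (f : Fin x → Fin c) (u : Fin x) (d' : Fin c),
      ∑ d, h d (Finset.univ.filter fun v => f v = d) = m.1 ∧
        ∑ d, h d (Finset.univ.filter fun v => Function.update f u d' v = d) = m.2) :
    M.ncard ≤ x * (c * c) * 3 ^ x := by
  have key : ∀ m : M, ∃ (u : Fin x) (d : Fin c) (d' : Fin c) (τ : Fin x → Fin 3), ∀ i : Fin 2,
      ((m.1.2 i : ℕ) : ℤ) - ((m.1.1 i : ℕ) : ℤ) =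
        ((h d (Finset.univ.filter fun v => τ v = 1) i : ℕ) : ℤ) +
          ((h d' (insert u (Finset.univ.filter fun v => τ v = 2)) i : ℕ) : ℤ) -
          ((h d (insert u (Finset.univ.filter fun v => τ v = 1)) i : ℕ) : ℤ) -
          ((h d' (Finset.univ.filter fun v => τ v = 2) i : ℕ) : ℤ) := by
    intro m
    obtain ⟨f, u, d', hf, hg⟩ := h4 _ m.2
    have hd : f u ≠ d' := by
      intro hfu
      apply h3 _ m.2
      rw [← hf, ← hg, ← hfu, Function.update_eq_self]
    obtain ⟨τ, hτ⟩ := diff_datum h f u d' hd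
    refine ⟨u, f u, d', τ, fun i => ?_⟩
    rw [← hf, ← hg]
    exact hτ i
  choose U D D' T hT using key
  have hinj : Function.Injective fun m : M => (U m, D m, D' m, T m) := by
    intro m m' heq
    simp only [Prod.mk.injEq] at heq
    obtain ⟨hU, hD, hD', hTT⟩ := heq
    have hv : ∀ i : Fin 2, ((m.1.2 i : ℕ) : ℤ) - ((m.1.1 i : ℕ) : ℤ) =
        ((m'.1.2 i : ℕ) : ℤ) - ((m'.1.1 i : ℕ) : ℤ) := by
      intro i
      rw [hT m i, hT m' i, hU, hD, hD', hTT]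
    obtain ⟨e1, e2⟩ :=
      eq_of_diff_eq h _ _ _ _ (h1 _ m.2) (h2 _ m.2) (h1 _ m'.2) (h2 _ m'.2) (h3 _ m.2) hv
    exact Subtype.ext (Prod.ext e1 e2)
  calc M.ncard = Nat.card M := (Nat.card_coe_set_eq M).symm
    _ ≤ Nat.card (Fin x × Fin c × Fin c × (Fin x → Fin 3)) := Nat.card_le_card_of_injective _ hinj
    _ = x * (c * c) * 3 ^ x := by
      simp only [Nat.card_prod, Nat.card_fun, Nat.card_fin]
      ring

end SingleMovePairBoundAux

/-- STUB P9 — **single-move datum bound.**  For a `c`-core design `h`, the ordered pairs `(p, p')` of DISTINCT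
strictly positively exposed points of the cloud `{P f}` (`P f = Σ_d h d (f⁻¹ d)`) such that `p = P f` and
`p' = P (update f u d')` for some configuration `f`, element `u` and core `d'` number at most `x · c² · 3^x`.
Proof: such a pair has `d' ≠ d := f u`, and `p' − p = h d T₁ + h d' (T₂ ∪ {u}) − h d (T₁ ∪ {u}) − h d' T₂`
(`T₁ = f⁻¹ d ∖ {u}`, `T₂ = f⁻¹ d'`) is a function of the datum `(u, d, d', τ)`, `τ : Fin x → Fin 3` the trace of
`(T₁, T₂)`; by P8 `stub_exposedChordUnique` two pairs with the same datum coincide, so the pair set injects into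
`Fin x × Fin c × Fin c × (Fin x → Fin 3)` (`SingleMovePairBoundAux.pair_bound`). [folklore] -/
theorem stub_singleMovePairBound (c x : ℕ) (h : Fin c → Finset (Fin x) → (Fin 2 →₀ ℕ)) :
    {pq : (Fin 2 →₀ ℕ) × (Fin 2 →₀ ℕ) |
        (∃ f : Fin x → Fin c, ∑ d, h d (Finset.univ.filter fun u => f u = d) = pq.1 ∧
          ∃ w : Fin 2 → ℝ, 0 < w 0 ∧ 0 < w 1 ∧ ∀ f' : Fin x → Fin c,
            ∑ d, h d (Finset.univ.filter fun u => f' u = d) ≠ pq.1 →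
            w 0 * ((pq.1 0 : ℕ) : ℝ) + w 1 * ((pq.1 1 : ℕ) : ℝ) <
              w 0 * (((∑ d, h d (Finset.univ.filter fun u => f' u = d)) 0 : ℕ) : ℝ) +
                w 1 * (((∑ d, h d (Finset.univ.filter fun u => f' u = d)) 1 : ℕ) : ℝ)) ∧
        (∃ f : Fin x → Fin c, ∑ d, h d (Finset.univ.filter fun u => f u = d) = pq.2 ∧
          ∃ w : Fin 2 → ℝ, 0 < w 0 ∧ 0 < w 1 ∧ ∀ f' : Fin x → Fin c,
            ∑ d, h d (Finset.univ.filter fun u => f' u = d) ≠ pq.2 →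
            w 0 * ((pq.2 0 : ℕ) : ℝ) + w 1 * ((pq.2 1 : ℕ) : ℝ) <
              w 0 * (((∑ d, h d (Finset.univ.filter fun u => f' u = d)) 0 : ℕ) : ℝ) +
                w 1 * (((∑ d, h d (Finset.univ.filter fun u => f' u = d)) 1 : ℕ) : ℝ)) ∧
        pq.1 ≠ pq.2 ∧
        ∃ (f : Fin x → Fin c) (u : Fin x) (d' : Fin c),
          ∑ d, h d (Finset.univ.filter fun v => f v = d) = pq.1 ∧
          ∑ d, h d (Finset.univ.filter fun v => Function.update f u d' v = d) = pq.2}.ncard ≤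
      x * (c * c) * 3 ^ x := by
  refine SingleMovePairBoundAux.pair_bound h _ ?_ ?_ ?_ ?_
  · exact fun _ hm => hm.1
  · exact fun _ hm => hm.2.1
  · exact fun _ hm => hm.2.2.1
  · exact fun _ hm => hm.2.2.2

end Summit.ValiantsHypothesis.ValiantsHypothesis.Theorems.NewtonUnitEquationsNewtonTauWeak
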